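import Mathlib
import Summits.Schanuel.Schanuel.Theorems.RigidCoreSchanuelOnLogFreeCoreAxesReduction
import Summits.Schanuel.Schanuel.Theorems.RigidCoreSchanuelOnLogFreeCoreExceptionalSubspacesIntersect

/-!
# Line `sector-split` of crux `RigidCore.SchanuelOnLogFreeCore`: the axes reduction for an
# arbitrary anchor on an axis

Crux `stmt-Schanuel-0970` (`Summit.Schanuel.Schanuel.Theses.RigidCore.SchanuelOnLogFreeCore`),
line `sector-split` (skeleton v11b, lead c5), registered calibration stub
`stub_anchorAxesReduction`: the axes reduction `stub_piFree_of_piFreeOnAxes` (p140402, anchor `π`)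
holds for EVERY anchor `η ∈ ℝ ∪ iℝ`, with the engine (exceptional subspaces are closed under `∩`,
`stub_exceptionalSubspacesIntersect`, p139838 = item stmt-Schanuel-9553) now a landed theorem rather
than a hypothesis:

* STRUCTURE (`AnchorAxes.exists_onAxes_of_isAlgebraic_anchor`): if `η ∈ ℝ ∪ iℝ` is algebraic over
  `ℚ(e^{a_1}, …, e^{a_d})` for algebraic `a_i`, then `η` is already algebraic over
  `ℚ(e^{u_1}, …, e^{u_n})` for a `ℚ`-linearly independent algebraic tuple `u` inside
  `span_ℚ(a)` whose entries are REAL or PURELY IMAGINARY (the exceptional subspace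
  `A = span_ℚ(a)` may be replaced by `A ∩ Ā`, which is conj-stable: `conj η = ±η`);
* COUNT (`stub_anchorAxesReduction`): consequently "`η` is free over the Lindemann–Weierstrass
  field" — `d + 1 ≤ trdeg ℚ(η, e^{a})` for all `ℚ`-free algebraic `a` — reduces to on-axes tuples.
  At `η = π` this is `PiFreeOnAxes → PiFreeOverLWField` (`KernelTower.piFreeOverLWField_of_onAxes`,
  re-deriving p140402 from the landed engine); at `d = 1` it contains the conjugation-off-axes
  theorem (item stmt-Schanuel-9551) for every axis anchor.

Proof = the proof of p140402 with `π` replaced by `η` (only `conj π = π` was used there; here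
`conj η = ±η` and `−η` is algebraic over a field iff `η` is).  Ingredients: Lindemann–Weierstrass
(tree theorem `algebraicIndependent_exp_holds`, PROVED), the landed engine, and the helpers of
`…AxesReduction` (`AxesReduction.exists_onAxes_frame`, `isAlgebraic_conj_adjoin_exp_image`,
`succ_le_trdeg_adjoin_insert`, `trdeg_adjoin_insert_le_of_isAlgebraic`).  No new definitions.

References: A. Baker, *Transcendental Number Theory* (1975), Ch. 1 Thm 1.4 (Lindemann–Weierstrass);
G. Diaz, J. Théor. Nombres Bordeaux 16 (2004) 535–553, doi:10.5802/jtnb.459 (conjugation device).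
-/

noncomputable section

-- `Summit.Schanuel.Schanuel.…` is the D-0017 single-problem layout
set_option linter.dupNamespace false

namespace Summit.Schanuel.Schanuel.Theorems.RigidCore

open Summit.Schanuel.Schanuel.Theses
open Literature.NumberTheory.Transcendental (algebraicIndependent_exp_holds)
open Summit.Schanuel.Schanuel.Theorems.AclSubsetLogFreeCore.Negative
open IntermediateField (adjoin subset_adjoin adjoin_le_iff)
open Complex (exp)
open Set Submodule

namespace AnchorAxes

/-- On the axes complex conjugation acts by a sign. [folklore] -/
theorem conj_eq_or {η : ℂ} (hη : η.im = 0 ∨ η.re = 0) :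
    (starRingEnd ℂ) η = η ∨ (starRingEnd ℂ) η = -η := by
  rcases hη with h | h
  · exact Or.inl (Complex.conj_eq_iff_im.2 h)
  · right
    apply Complex.ext
    · simp [h]
    · simp

/-- **Structure of the exceptional exponents of an axis anchor.** If `η ∈ ℝ ∪ iℝ` is algebraic
over `ℚ(e^{a_1}, …, e^{a_d})` with all `a_i` algebraic, then `η` is algebraic over
`ℚ(e^{u_1}, …, e^{u_n})` for some `ℚ`-linearly independent algebraic `u` inside `span_ℚ(a)` with
every `u_i` real or purely imaginary (replace `A = span_ℚ(a)` by the conj-stable `A ∩ Ā` using the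
intersection engine, then take an on-axes frame). [cite: BakerTNT1975, Ch. 1 Thm 1.4] -/
theorem exists_onAxes_of_isAlgebraic_anchor {η : ℂ} (hax : η.im = 0 ∨ η.re = 0) {d : ℕ}
    {a : Fin d → ℂ} (ha : ∀ i, IsAlgebraic ℚ (a i))
    (h1 : IsAlgebraic (adjoin ℚ (Set.range (exp ∘ a))) η) :
    ∃ (n : ℕ) (u : Fin n → ℂ), (∀ i, u i ∈ span ℚ (Set.range a)) ∧ (∀ i, IsAlgebraic ℚ (u i)) ∧
      (∀ i, (u i).im = 0 ∨ (u i).re = 0) ∧ LinearIndependent ℚ u ∧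
      IsAlgebraic (adjoin ℚ (Set.range (exp ∘ u))) η := by
  -- the span `A = span_ℚ(a) ≤ ℚ̄`
  set A : Submodule ℚ ℂ := span ℚ (Set.range a) with hA
  have hAalg : ∀ z ∈ A, IsAlgebraic ℚ z := fun z hz => AxesReduction.isAlgebraic_of_mem_span ha hz
  have h2 : IsAlgebraic (adjoin ℚ (exp '' (A : Set ℂ))) η :=
    isAlgebraic_of_le (IntermediateField.adjoin.mono ℚ _ _
      (by rintro _ ⟨i, rfl⟩; exact ⟨a i, subset_span ⟨i, rfl⟩, rfl⟩)) h1
  -- conjugation: `η` is algebraic over `ℚ(e^{Ā})` (`conj η = ±η`)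
  set A' : Submodule ℚ ℂ := A.map conjQ.toLinearMap with hA'
  have hA'alg : ∀ z ∈ A', IsAlgebraic ℚ z := fun z hz => by
    obtain ⟨y, hy, rfl⟩ := Submodule.mem_map.1 hz
    exact (hAalg y hy).algHom conjQ
  have h3 : IsAlgebraic (adjoin ℚ (exp '' (A' : Set ℂ))) η := by
    have h := AxesReduction.isAlgebraic_conj_adjoin_exp_image h2
    rw [conjQ_apply] at h
    have h' : IsAlgebraic (adjoin ℚ (exp '' (⇑conjQ.toLinearMap '' (A : Set ℂ)))) η := by
      rcases conj_eq_or hax with hc | hc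
      · rwa [hc] at h
      · rw [hc] at h
        simpa using h.neg
    rwa [hA', Submodule.map_coe]
  -- engine: `η` is algebraic over `ℚ(e^{A ∩ Ā})`
  have h4 := stub_exceptionalSubspacesIntersect η A A' hAalg hA'alg h2 h3
  -- `A ∩ Ā` is finite-dimensional and conj-stable: an on-axes frame `u`
  haveI : FiniteDimensional ℚ A := FiniteDimensional.span_of_finite ℚ (Set.finite_range a)
  haveI : FiniteDimensional ℚ ↥(A ⊓ A') := finiteDimensional_of_le inf_le_left
  have hUconj : ∀ u ∈ A ⊓ A', (starRingEnd ℂ) u ∈ A ⊓ A' := by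
    intro u hu
    obtain ⟨huA, huA'⟩ := Submodule.mem_inf.1 hu
    obtain ⟨y, hy, hyu⟩ := Submodule.mem_map.1 huA'
    refine Submodule.mem_inf.2 ⟨?_, Submodule.mem_map.2 ⟨u, huA, rfl⟩⟩
    have h : (starRingEnd ℂ) u = y := by rw [← hyu]; simp
    rw [h]
    exact hy
  obtain ⟨n, u, huU, hax', huli, hUle⟩ := AxesReduction.exists_onAxes_frame (A ⊓ A') hUconj
  -- `η` is algebraic over `ℚ(e^{u})`
  set Ku := adjoin ℚ (Set.range (exp ∘ u)) with hKu
  have h6 : IsAlgebraic Ku η := by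
    refine AxesReduction.isAlgebraic_of_subset_algebraicClosure Ku ?_ h4
    rintro _ ⟨x, hx, rfl⟩
    exact AxesReduction.exp_mem_algebraicClosure_of_mem_span u Ku
      (fun i => subset_adjoin ℚ _ ⟨i, rfl⟩) (hUle hx)
  exact ⟨n, u, fun i => (Submodule.mem_inf.1 (huU i)).1,
    fun i => AxesReduction.isAlgebraic_of_mem_span ha (Submodule.mem_inf.1 (huU i)).1, hax', huli, h6⟩

/-- Algebraic over `ℚ(∅) = ⊥` means algebraic over `ℚ`. [folklore] -/
theorem isAlgebraic_rat_of_isAlgebraic_adjoin_empty {x : ℂ}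
    (h : IsAlgebraic (adjoin ℚ (∅ : Set ℂ)) x) : IsAlgebraic ℚ x :=
  h.of_ringHom_of_comp_eq (algebraMap ℚ (adjoin ℚ (∅ : Set ℂ))) (RingHom.id ℂ)
    (fun y => by
      have hy : (y : ℂ) ∈ (⊥ : IntermediateField ℚ ℂ) := by
        rw [← IntermediateField.adjoin_empty]
        exact y.2
      obtain ⟨r, hr⟩ := IntermediateField.mem_bot.1 hy
      exact ⟨r, Subtype.ext hr⟩)
    Function.injective_id (Subsingleton.elim _ _)

end AnchorAxes

/-- **Stub `stub_anchorAxesReduction` of line `sector-split`** (registered signature, v11b): for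
an anchor `η ∈ ℝ ∪ iℝ`, freeness of `η` over the Lindemann–Weierstrass field
(`d + 1 ≤ trdeg ℚ(η, e^{a})` for every `ℚ`-free algebraic `a`) follows from the same count for
tuples ON THE AXES.  The anchor-agnostic form of `stub_piFree_of_piFreeOnAxes` (p140402), with the
engine `stub_exceptionalSubspacesIntersect` (p139838) discharged. [cite: BakerTNT1975, Ch. 1 Thm 1.4] -/
theorem stub_anchorAxesReduction :
    ∀ (η : ℂ), (η.im = 0 ∨ η.re = 0) →
      (∀ (n : ℕ) (u : Fin n → ℂ), (∀ i, IsAlgebraic ℚ (u i)) → (∀ i, (u i).im = 0 ∨ (u i).re = 0) →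
        LinearIndependent ℚ u →
        ((n + 1 : ℕ) : Cardinal) ≤ Algebra.trdeg ℚ
          ↥(IntermediateField.adjoin ℚ (insert η (Set.range (Complex.exp ∘ u))))) →
      ∀ (d : ℕ) (a : Fin d → ℂ), (∀ i, IsAlgebraic ℚ (a i)) → LinearIndependent ℚ a →
        ((d + 1 : ℕ) : Cardinal) ≤ Algebra.trdeg ℚ
          ↥(IntermediateField.adjoin ℚ (insert η (Set.range (Complex.exp ∘ a)))) := by
  intro η hax hAxes d a ha hli
  -- Lindemann–Weierstrass: if the count fails, `η` is algebraic over `ℚ(e^{a})`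
  have hLW : AlgebraicIndependent ℚ (exp ∘ a) := algebraicIndependent_exp_holds a ha hli
  by_contra hlt
  have h1 : IsAlgebraic (adjoin ℚ (Set.range (exp ∘ a))) η := by
    by_contra htr
    exact hlt (AxesReduction.succ_le_trdeg_adjoin_insert hLW htr)
  obtain ⟨n, u, -, hualg, huax, huli, hu⟩ := AnchorAxes.exists_onAxes_of_isAlgebraic_anchor hax ha h1
  -- `trdeg ℚ(η, e^{u}) ≤ n`, against the on-axes count at `u`
  have hup := AxesReduction.trdeg_adjoin_insert_le_of_isAlgebraic (exp ∘ u) hu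
  have h := (hAxes n u hualg huax huli).trans hup
  norm_cast at h
  omega

/-- At the anchor `π`: residue 1′ `PiFreeOnAxes` implies residue 1 `PiFreeOverLWField`
(item stmt-Schanuel-9545) outright — p140402 with its engine hypothesis discharged by p139838.
[cite: BakerTNT1975, Ch. 1 Thm 1.4] -/
theorem KernelTower.piFreeOverLWField_of_onAxes
    (hAxes : ∀ (n : ℕ) (u : Fin n → ℂ), (∀ i, IsAlgebraic ℚ (u i)) →
      (∀ i, (u i).im = 0 ∨ (u i).re = 0) → LinearIndependent ℚ u →
      ((n + 1 : ℕ) : Cardinal) ≤ Algebra.trdeg ℚ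
        ↥(IntermediateField.adjoin ℚ (insert (Real.pi : ℂ) (Set.range (Complex.exp ∘ u))))) :
    GaussianStokesSector.PiFreeOverLWField :=
  fun d a ha hli => stub_anchorAxesReduction (Real.pi : ℂ) (Or.inl (Complex.ofReal_im _)) hAxes d a ha hli

/-- **The exceptional exponents of an axis anchor lie on the axes, `d = 1`:** if `η ∈ ℝ ∪ iℝ` is
transcendental and algebraic over `ℚ(e^{α})` for an algebraic `α`, then `α` is real or purely
imaginary (the structure theorem at `d = 1`: the frame `u` is non-empty because `η` is
transcendental, and `u_0 = q α` lies on an axis). [cite: BakerTNT1975, Ch. 1 Thm 1.4] -/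
theorem KernelTower.onAxes_of_isAlgebraic_anchor_adjoin_exp {η α : ℂ} (hax : η.im = 0 ∨ η.re = 0)
    (hη : Transcendental ℚ η) (hα : IsAlgebraic ℚ α)
    (h : IsAlgebraic (adjoin ℚ ({Complex.exp α} : Set ℂ)) η) : α.im = 0 ∨ α.re = 0 := by
  have h1 : IsAlgebraic (adjoin ℚ (Set.range (exp ∘ fun _ : Fin 1 => α))) η := by
    have hr : Set.range (exp ∘ fun _ : Fin 1 => α) = {Complex.exp α} := by
      ext z
      constructor
      · rintro ⟨_, rfl⟩; rfl
      · rintro rfl; exact ⟨0, rfl⟩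
    rwa [hr]
  obtain ⟨n, u, huA, -, huax, huli, hu⟩ :=
    AnchorAxes.exists_onAxes_of_isAlgebraic_anchor hax (fun _ => hα) h1
  -- `n ≠ 0`: otherwise `η` would be algebraic over `ℚ(∅) = ℚ`
  rcases Nat.eq_zero_or_pos n with hn | hn
  · subst hn
    exact (hη (AnchorAxes.isAlgebraic_rat_of_isAlgebraic_adjoin_empty
      (isAlgebraic_of_le (le_of_eq (by rw [Set.range_eq_empty])) hu))).elim
  · -- `u ⟨0, hn⟩ = q • α` lies on an axis and `q ≠ 0`
    set i0 : Fin n := ⟨0, hn⟩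
    have hmem := huA i0
    rw [show Set.range (fun _ : Fin 1 => α) = {α} by ext; simp, Submodule.mem_span_singleton] at hmem
    obtain ⟨q, hq⟩ := hmem
    have hq0 : q ≠ 0 := by
      rintro rfl
      exact huli.ne_zero i0 (by rw [← hq, zero_smul])
    rcases huax i0 with h0 | h0
    · left
      rw [← hq, Rat.smul_def, Complex.mul_im] at h0
      simpa [hq0] using h0
    · right
      rw [← hq, Rat.smul_def, Complex.mul_re] at h0
      simpa [hq0] using h0

end Summit.Schanuel.Schanuel.Theorems.RigidCore

end
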